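import Summits.CriticalPhenomena.PercolationContinuityZ3.Theorems.Transplant.SkelPhiConcSchedule
import Summits.CriticalPhenomena.PercolationContinuityZ3.Theorems.Transplant.SkelConcParamsKit
import HarnessLib

/-!
# D″ L7′ params, part 2 (φ-level, consumer-independent): THE q-LEVEL FIBRE BLOCK OF `signChoice₀` AS PARAMETRIC DEFINITIONS — `Skelφ.Prm.SchedIn`
# (the p-level numbers it reads: envelope unit `rmax`, length unit `u`, clamp scale `M`, fat radii `ψM = ψ M` / `ψtop = ψ (6u)`, kit reach, and the
# excess radius `Rex` at the running density) ↦ `dL, LA, Lp (= L′), E₀, gap` and the schedule `Skelφ.Prm.sched S P := Skelφ.concRadii2S P (gap S) 0 (E₀ S) (Lp S)`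
# (p2-g7 p248611), with the FIBRE-DIRECTION FACTS of the node of record (SkelConcParamsAtQ §Sched, p238500) restated for them VERBATIM in shape
# (`r ↦ rmax`; DPRIME-SCOPE §0 item 7: "the fibre direction is untouched by D″") and `WFS2` — ledger HOME/prim-bschramm-stmt/SIGN-PARAMS.md §0 (c10), §1S

builds on p205010 (kernel theorem, internal audit signed; external expert review pending) — nothing in this file uses p205010.
Status sentence (coordinator 2026-08-20T04:30Z): "θ(p_c) = 0 on ℤ^d, all d ≥ 2 — kernel-verified (Lean 4/Mathlib, standard axioms); internal adversarial
audit SIGNED 2026-08-20 04:29Z; external expert review pending."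
Lane `prim-bschramm-*`, seat `prim-bschramm-stmt` (gen 9); helper file (`--supports stmt-CriticalPhenomena-4575`).
Design: the drift terms are PARAMETERS (CONC-PARAMS-GENERIC §1), so `signChoice₀` instantiates `SchedIn` from its constants at `(p, O, q)` and no value
below is frozen by this file.  Values (gen 7, CONC-PARAMS-GENERIC (D12)): `dL := 24 u + 8 M + 12`, `L_A := 24 rmax + 2 (ψtop + ψM) + Rex (2 ψM) + dL`,
`L′ := L_A + ψtop + ψM + 12 u + 2 M + reachK`, `E₀ := L′ + 45 rmax + ψM`, `gap := gapFn L′ (Rex · + 100 rmax)`.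
* §1 `SchedIn`, `dL`, `LA`, `Lp`, `E₀`, `gap`, `sched`;
* §2 the facts: `hgap_face` (`2L′ + Rex(ρ+1) + 100 rmax ≤ gap ρ`), `hgapL`, `dG_le_gap`, `twenty_rmax_le_gap`, `one_le_gap`, `hsch`, `hRt`, `hL_face`, `hL_reach`,
  `reachK_le_Lp`, `Lp_le_E₀`, `planar_le_E₀` (`45 rmax + ψM ≤ E₀`), `fortyfour_le_E₀` (under `4 ≤ rmax`), `planar_le_LA`, `LA_reach_le_Lp` (under `1 ≤ u`), `two_le_E₀`,
  `one_le_Lp`; §3 **`sched_WFS2`** (`Skelφ.concRadii2S_WFS2`) and `twenty_rmax_le_gap` for p2's `off2_le_Erad`/`concRadii2S_rQ_eq_of_norm_le`.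
[cite: KozmaNitzan2024, §4 Theorem 6 (pp. 25–31): the order of constants; Lemma 12 (p. 24)]
-/

namespace Summit.CriticalPhenomena.PercolationContinuityZ3.Theorems.Transplant

namespace Skelφ

namespace Prm

open Literature.Probability.Percolation Literature.Probability.LatticeModels SimpleGraph
open BoxProdZ2 (ConcRadiiG Erad Frad gapFn le_gapFn one_le_gapFn)
open SkelConc (two_mul_add_add_le_gapFn_drift le_gapFn_drift sch_gapFn_drift Frad_one_gapFn_drift)

/-! ## §1 The inputs and the q-level definitions -/

/-- **The p-level numbers the fibre block reads** (all fixed before the running density except `Rex`, the excess radius AT the running density,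
passed already instantiated). [this work] -/
structure SchedIn where
  /-- the envelope planar unit `max (r 0) (r 1)` of the two-unit cells -/
  rmax : ℕ
  /-- the length unit of the prism-scale allowance (gen 7: `t = r/4`) -/
  u : ℕ
  /-- the clamp / kit scale `M` -/
  M : ℕ
  /-- the fat radius at the kit scale, `ψ M` -/
  ψM : ℕ
  /-- the fat radius at the largest prism scale used, `ψ (6u)` -/
  ψtop : ℕ
  /-- the kit-reach allowance -/
  reachK : ℕ
  /-- the excess radius at the running density, by entrance depth -/
  Rex : ℕ → ℕ

variable (S : SchedIn)

/-- The prism-scale / slab allowance `dL := 24 u + 8 M + 12`. [this work] -/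
def dL : ℕ := 24 * S.u + 8 * S.M + 12

/-- **The inner radius of the face step's routes** `L_A := 24 rmax + 2 (ψtop + ψM) + Rex (2 ψM) + dL`. [this work] -/
def LA : ℕ := 24 * S.rmax + 2 * (S.ψtop + S.ψM) + S.Rex (2 * S.ψM) + dL S

/-- **The collar width** `L′ := L_A + ψtop + ψM + 12 u + 2 M + reachK`. [this work] -/
def Lp : ℕ := LA S + S.ψtop + S.ψM + 12 * S.u + 2 * S.M + S.reachK

/-- **The root seed radius** `E₀ := L′ + 45 rmax + ψM`. [this work] -/
def E₀ : ℕ := Lp S + 45 * S.rmax + S.ψM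

/-- **The gap function** `gap := gapFn L′ (Rex · + 100 rmax)` (`= 2L′ + 1 + Rex(ρ+1) + 100 rmax`). [this work] -/
def gap : ℕ → ℕ := gapFn (Lp S) fun n => S.Rex n + 100 * S.rmax

/-- **The radius schedule at the running density** over two-unit cells `P`: p2-g7's `Skelφ.concRadii2S P gap 0 E₀ L′`. [this work] -/
noncomputable def sched (P : PCells2) : ConcRadiiG := concRadii2S P (gap S) (fun _ => 0) (E₀ S) (Lp S)

/-! ## §2 The fibre-direction facts (names of SkelConcParamsAtQ §Sched) -/

/-- The gap unfolds to `2L′ + 1 + Rex(ρ+1) + 100 rmax`. [folklore] -/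
theorem gap_eq (ρ : ℕ) : gap S ρ = 2 * Lp S + 1 + S.Rex (ρ + 1) + 100 * S.rmax := SkelConc.gapFn_drift _ _ _ ρ

/-- `(F)`: `2 L′ + Rex (ρ+1) + 100 rmax ≤ gap ρ`. [folklore] -/
theorem hgap_face (ρ : ℕ) : 2 * Lp S + S.Rex (ρ + 1) + 100 * S.rmax ≤ gap S ρ := two_mul_add_add_le_gapFn_drift _ _ _ ρ

/-- `(C)`: `L′ ≤ gap ρ`. [folklore] -/
theorem hgapL (ρ : ℕ) : Lp S ≤ gap S ρ := le_gapFn _ _ ρ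

/-- `100 rmax ≤ gap ρ`. [folklore] -/
theorem dG_le_gap (ρ : ℕ) : 100 * S.rmax ≤ gap S ρ := le_gapFn_drift _ _ _ ρ

/-- `20 rmax ≤ gap ρ` (p2-g7's `off2_le_Erad` / `concRadii2S_rQ_eq_of_norm_le`). [folklore] -/
theorem twenty_rmax_le_gap (ρ : ℕ) : 20 * S.rmax ≤ gap S ρ := le_trans (by omega) (dG_le_gap S ρ)

/-- `1 ≤ gap ρ`. [folklore] -/
theorem one_le_gap (ρ : ℕ) : 1 ≤ gap S ρ := one_le_gapFn _ _ ρ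

/-- `(C)`: `Rex (E g + 1) + 100 rmax + L′ ≤ E (g + 1)` for `E := Erad gap 0 E₀`. [folklore] -/
theorem hsch (g : ℕ) : S.Rex (Erad (gap S) (fun _ => 0) (E₀ S) g + 1) + 100 * S.rmax + Lp S ≤ Erad (gap S) (fun _ => 0) (E₀ S) (g + 1) :=
  sch_gapFn_drift _ _ _ _ g

/-- `(R)`: the root tube radius `F 1 − L′ = E₀ + L′ + 1 + Rex (E₀ + 1) + 100 rmax`. [folklore] -/
theorem hRt : Frad (gap S) (fun _ => 0) (E₀ S) 1 - Lp S = E₀ S + Lp S + 1 + S.Rex (E₀ S + 1) + 100 * S.rmax := Frad_one_gapFn_drift _ _ _ _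

/-- `L_A + ψM ≤ L′`. [folklore] -/
theorem hL_face : LA S + S.ψM ≤ Lp S := by unfold Lp; omega

/-- `ψtop + ψM + 12 u + 2 M ≤ L′` (the prism-scale allowance). [folklore] -/
theorem hL_reach : S.ψtop + S.ψM + 12 * S.u + 2 * S.M ≤ Lp S := by unfold Lp; omega

/-- `reachK ≤ L′`. [folklore] -/
theorem reachK_le_Lp : S.reachK ≤ Lp S := by unfold Lp; omega

/-- `L′ ≤ E₀`. [folklore] -/
theorem Lp_le_E₀ : Lp S ≤ E₀ S := by unfold E₀; omega

/-- **`45 rmax + ψM ≤ E₀`** (column room: the root corridor sets reach planar level `22 r`). [folklore] -/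
theorem planar_le_E₀ : 45 * S.rmax + S.ψM ≤ E₀ S := by unfold E₀; omega

/-- **`44 rmax + 4 ≤ E₀`** for `rmax ≥ 4` (two-unit cells have `r_i ≥ 20`). [folklore] -/
theorem fortyfour_le_E₀ (h : 4 ≤ S.rmax) : 44 * S.rmax + 4 ≤ E₀ S := by unfold E₀; omega

/-- `24 rmax ≤ L_A`. [folklore] -/
theorem planar_le_LA : 24 * S.rmax ≤ LA S := by unfold LA; omega

/-- `Rex (2 ψM) ≤ L_A` (the inner excess radius fits in the inner graph radius). [folklore] -/
theorem Rex_le_LA : S.Rex (2 * S.ψM) ≤ LA S := by unfold LA; omega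

/-- `dL ≤ L_A` and the value of `dL`. [folklore] -/
theorem dL_le_LA : dL S ≤ LA S ∧ dL S = 24 * S.u + 8 * S.M + 12 := ⟨by unfold LA; omega, rfl⟩

/-- `L_A + 2 ψM + reachK + 1 ≤ L′` for `u ≥ 1` and `ψM ≤ ψtop` (fat radius monotone). [folklore] -/
theorem LA_reach_le_Lp (hu : 1 ≤ S.u) (hψ : S.ψM ≤ S.ψtop) : LA S + 2 * S.ψM + S.reachK + 1 ≤ Lp S := by unfold Lp; omega

/-- `L_A + ψtop + ψM + reachK ≤ L′` (both collars and the kit reach). [folklore] -/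
theorem LA_collars_le_Lp : LA S + S.ψtop + S.ψM + S.reachK ≤ Lp S := by unfold Lp; omega

/-- `2 ≤ E₀` (indeed `12 ≤ dL ≤ L_A ≤ L′ ≤ E₀`). [folklore] -/
theorem two_le_E₀ : 2 ≤ E₀ S := by unfold E₀ Lp LA dL; omega

/-- `1 ≤ L′`. [folklore] -/
theorem one_le_Lp : 1 ≤ Lp S := by unfold Lp LA dL; omega

/-! ## §3 Well-formedness of the schedule -/

/-- **`WFS2 P (sched S P)`** — p2-g7's `concRadii2S_WFS2` (every gap `≥ 1`, `E₀ ≥ 2`, `L′ ≥ 1`): the `WFHolds` half of the choice function is immediate.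
[this work] -/
theorem sched_WFS2 (P : PCells2) : WFS2 P (sched S P) :=
  concRadii2S_WFS2 P (gap S) (fun _ => 0) (E₀ S) (Lp S) (one_le_gap S) (two_le_E₀ S) (one_le_Lp S)

/-- The schedule by name. [folklore] -/
theorem sched_eq (P : PCells2) : sched S P = concRadii2S P (gap S) (fun _ => 0) (E₀ S) (Lp S) := rfl

end Prm

end Skelφ

end Summit.CriticalPhenomena.PercolationContinuityZ3.Theorems.Transplant
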